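import Literature.AlgebraicGeometry.ComplexMultiplication.CyclotomicFermatCMTypesPrimePowerLevelSimple
import HarnessLib

/-!
# Koblitz–Rohrlich's THEOREM 2, the converse direction at EVERY level: the two printed families `{N/M, wN/M, w²N/M}` (`1 + w + w² = 0`)
# and `{N/M, wN/M, −(1+w)N/M}` (`w² = 1`, `w ≠ ±1`) are NOT simple — the second family is a boundary case

Layer `Literature/AlgebraicGeometry/ComplexMultiplication`, namespace `…ComplexMultiplication.CyclotomicFermatCMType`; sequel of
`CyclotomicFermatCMTypesPrimePowerLevelSimple` (Theorem 2 at prime-power level; the stabiliser `W_{1,a,−1−a}` for UNIT triples) — the siblings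
`…OddLevelSimple`, `…CoprimeSixLevelSimple`, `…OddTwoPrimeLevelSimple` prove the EQUIVALENCE "simple ⟺ ¬(1 + a + a² = 0 ∧ a ≠ 1)" for unit
triples `(1, a, −1−a)` wherever the Proposition's count holds.  THIS FILE proves the hypothesis-free half of THEOREM 2 at EVERY level `M`:
both printed families consist of non-simple lattices — including the SECOND family, which never occurs among unit triples.  THEOREMS ONLY (no
definition, no named fact, no `sorry`).

THE SOURCE.  N. Koblitz, D. Rohrlich, *Simple factors in the Jacobian of a Fermat curve*, Canad. J. Math. **30** (1978) 1183–1205.  P. 1184: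
"Let `W_{r,s} = {w ∈ (ℤ/Mℤ)* : wH_{r,s} = H_{r,s}}`.  Then `W_{r,s}` is a subgroup of `(ℤ/Mℤ)*`, and `L_{r,s}` is simple if and only if
`W_{r,s} = {1}`" (Shimura–Taniyama [7]); p. 1185: "if `w` is in `W_{r,s,t}`, then `H_{r,s,t} = wH_{r,s,t} = H_{⟨w⁻¹r⟩,⟨w⁻¹s⟩,⟨w⁻¹t⟩}` … If at
least one of `rM/N, sM/N, tM/N` is prime to `M` … then one deduces that for `w ≠ 1`, either `1 + w + w² = 0` in `ℤ/Mℤ` or `w² = 1` in `ℤ/Mℤ`.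
It follows that after multiplying by an element of `(ℤ/Nℤ)*`, we have `{r,s,t} = {N/M, ⟨wN/M⟩, ⟨w²N/M⟩}` or `{r,s,t} = {N/M, ⟨wN/M⟩,
⟨−(1+w)N/M⟩}` respectively"; THEOREM 2 (pp. 1185–1186): "Suppose `N` is prime to `6`.  The only lattices `L_{r,s,t}` which are not simple are
those for which `{r, s, t}` is equivalent to a triple of the form `{N/M, ⟨wN/M⟩, ⟨w²N/M⟩}`, for some divisor `M` of `N`, and some `w ∈ ℤ/Mℤ`
such that `1 + w + w² = 0`, or to a triple of the form `{N/M, ⟨wN/M⟩, ⟨−(1+w)N/M⟩}`, for some divisor `M` of `N`, and some `w ∈ ℤ/Mℤ` such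
that `w² = 1`, `w ≠ ±1`."

READING.  K–R's lattice `L_{r,s,t}` lives at the level `M = N/gcd(N,r,s,t)` with `H_{r,s,t} ⊂ (ℤ/Mℤ)*`; dividing the two families by `N/M`
they are the triples `(1, w, w²)` and `(1, w, −1−w)` MODULO `M`, of residues summing to `0`, with `H ⊂ (ℤ/M)ˣ` the tree's `fermatCMType M`.
The converse direction of Theorem 2 ("these are not simple") needs no hypothesis on `M`: `w` permutes the triple (`w·(1, w, w²) = (w, w², 1)`
as `w³ = 1`; `w·(1, w, −1−w) = (w, 1, −w−1)` as `w² = 1`), so `wH = H` with `w ≠ 1`, i.e. `W ≠ {1}`, and by Shimura–Taniyama (tree: Shimura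
§8.2 Prop. 26, `isPrimitive_iff_hasTrivialStabilizer`, `not_isSimple_of_isCMTypeRealisation_of_not_isPrimitive`) no abelian variety of type
`Φ_H` is simple.  In the SECOND family `1 + w` is never a unit (`(w − 1)(w + 1) = 0`, `w ≠ 1`), so the entry `−(1+w)` is a non-unit,
non-zero residue: this family lies in K–R's "boundary cases" and is invisible to the unit-triple theorems of the siblings.

## What is proved (every level `M ≥ 1`, `[NeZero M]`; realisation statements for `M > 2`)

* §1 `forall_mem_iff_mul_mem_of_multiset_eq` — a unit `h` permuting `(r, s, t)` stabilises `H_{r,s,t}` (`x ∈ H ↔ hx ∈ H`);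
  `not_hasTrivialStabilizer_of_multiset_eq` (`h ≠ 1` ⟹ `W ≠ {1}`); `not_isSimple_of_multiset_eq` (no realisation of `Φ_{H_{r,s,t}}` is simple).
* §2 FIRST FAMILY `(1, w, w²)`, `1 + w + w² = 0`, `w ≠ 1`: `w` is a unit with `w³ = 1`, the triple is `(1, w, −1−w)`;
  `forall_mem_iff_mul_mem_firstFamily` (`wH = H`), `not_hasTrivialStabilizer_firstFamily`, **`not_isSimple_firstFamily`**,
  `exists_not_isSimple_firstFamily` (a non-simple abelian variety of dimension `φ(M)/2` of this type exists).
* §3 SECOND FAMILY `(1, w, −1−w)`, `w² = 1`, `w ≠ 1`, `w ≠ −1`: `not_isUnit_one_add_of_sq_eq_one` (**`1 + w` is NOT a unit** — boundary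
  case) yet `−1−w ≠ 0`; `forall_mem_iff_mul_mem_secondFamily` (`wH = H`), `not_hasTrivialStabilizer_secondFamily`,
  **`not_isSimple_secondFamily`**, `exists_not_isSimple_secondFamily`.
* §4 the smallest instance prime to `6`: `M = 35`, `w = 6` (`6² ≡ 1`, `6 ≢ ±1`): the triple `(1, 6, 28)`, `H_{1,6,28}` computed, `6H = H`.

## Honest column / NOT here

* Only the converse ("not simple") direction of Theorem 2; the forward direction in the boundary cases is K–R §3's Proposition (pp.
  1193–1197), NOT typed; for unit triples it is the siblings' (`isSimple_of_fermat_one_iff_*`).  The factor count "`L` is isogenous to a product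
  of `|W|` isomorphic simple factors" (p. 1184) is NOT typed.
* K–R normalise triples by "multiplying by an element of `(ℤ/Nℤ)*`" and permuting; the statements here are for the normalised representatives
  `(1, w, w²)` / `(1, w, −1−w)`; unit multiples and permutations are covered by the siblings' `mem_fermatCMType_mul_iff_of_isUnit` /
  `fermatCMType_eq_of_multiset_eq` (used in §1).
* As in the siblings, "simple" is said of every abelian variety realising the CM type `Φ_H` of `ℚ(ζ_M)` (`IsCMTypeRealisation`), not of the
  Fermat Jacobian factor itself.
* Private: `isUnit_of_one_add_add_sq`, `pow_three_of_one_add_add_sq`, `thirtyFive_facts`.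

## References

* [KoblitzRohrlich1978] N. Koblitz, D. Rohrlich, Canad. J. Math. 30 (1978) 1183–1205: §1 (pp. 1184–1185), Theorem 2 (pp. 1185–1186).
* [Shimura1998] G. Shimura, *Abelian Varieties with Complex Multiplication and Modular Functions*, §8.2 Prop. 26, §6.2 Thm. 3 (through
  `CyclotomicCMTypeResidueSets`, `SimpleIffPrimitiveCMType`, `CMAbelianVarietyRealisedHolds`).

## Provenance

Cell `pub-hodgecm2` (COR-CM), literature seat `lit-deligne-3` gen 35 (claim KR78-THM2-FAMILIES; count-neutral, own lane).
-/

noncomputable section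

open NumberField

namespace Literature.AlgebraicGeometry.ComplexMultiplication

open Literature.NumberTheory.ComplexMultiplication
open Literature.AlgebraicGeometry.HodgeTheory
open Literature.AlgebraicGeometry.Pohlmann1968 Literature.AlgebraicGeometry.Pohlmann1968.Cyclotomic
open CyclotomicCMTypeResidueSets (IsCMResidueSet HasTrivialStabilizer unitResidues)

namespace CyclotomicFermatCMType

/-! ## §1 A unit permuting the triple stabilises `H_{r,s,t}`; then no realisation is simple -/

section Stabiliser

variable {M : ℕ} [NeZero M]

omit [NeZero M] in
/-- Transposition of the first two entries of a triple (private copy of the siblings'). [folklore] -/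
private theorem triple_swap₁₂ (x y z : ZMod M) : ({x, y, z} : Multiset (ZMod M)) = {y, x, z} := by
  simp only [Multiset.insert_eq_cons]
  exact Multiset.cons_swap x y {z}

omit [NeZero M] in
/-- Transposition of the last two entries of a triple (private copy of the siblings'). [folklore] -/
private theorem triple_swap₂₃ (x y z : ZMod M) : ({x, y, z} : Multiset (ZMod M)) = {x, z, y} :=
  congrArg (insert x) (Multiset.pair_comm y z)

/-- **"if `w` is in `W_{r,s,t}`, then `H_{r,s,t} = wH_{r,s,t} = H_{⟨w⁻¹r⟩,⟨w⁻¹s⟩,⟨w⁻¹t⟩}`", read backwards**: a unit `h` with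
`{hr, hs, ht} = {r, s, t}` (it permutes the triple) satisfies `x ∈ H_{r,s,t} ⟺ hx ∈ H_{r,s,t}`, i.e. `h ∈ W_{r,s,t}`.
[cite: KoblitzRohrlich1978, §1 (p. 1185)] -/
theorem forall_mem_iff_mul_mem_of_multiset_eq {r s t h : ZMod M} (hh : IsUnit h)
    (hperm : ({h * r, h * s, h * t} : Multiset (ZMod M)) = {r, s, t}) (x : ZMod M) :
    x ∈ fermatCMType M r s t ↔ h * x ∈ fermatCMType M r s t := by
  have h1 := mem_fermatCMType_mul_iff_of_isUnit hh r s t x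
  rw [fermatCMType_eq_of_multiset_eq hperm] at h1
  exact h1

/-- A unit `h ≠ 1` permuting the triple makes the stabiliser `W_{r,s,t}` non-trivial. [cite: KoblitzRohrlich1978, §1 (pp. 1184–1185)] -/
theorem not_hasTrivialStabilizer_of_multiset_eq {r s t h : ZMod M} (hh : IsUnit h) (hh1 : h ≠ 1)
    (hperm : ({h * r, h * s, h * t} : Multiset (ZMod M)) = {r, s, t}) :
    ¬HasTrivialStabilizer M (fermatCMType M r s t) := by
  intro hW
  refine hh1 (hW h ((mem_unitResidues_iff_isUnit h).2 hh) fun c _ => ?_)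
  rw [mul_comm c h]
  exact (forall_mem_iff_mul_mem_of_multiset_eq hh hperm c).symm

variable {L : Type} [Field L] [NumberField L] [IsCyclotomicExtension {M} ℚ L]
  {A : Motives.AbelianVariety ℂ} {ι : 𝓞 L →+* CategoryTheory.End A} {θ : L →+* Module.End ℂ (complexBetti A.X 1)}

/-- **"`L_{r,s}` is simple if and only if `W_{r,s} = {1}`", the direction used by Theorem 2**: if a unit `h ≠ 1` permutes `(r, s, t)`, no
abelian variety of type `(ℚ(ζ_M); Φ_{H_{r,s,t}})` is simple (Shimura §8.2 Prop. 26 = tree `isPrimitive_iff_hasTrivialStabilizer`).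
[cite: KoblitzRohrlich1978, §1 (p. 1184)] [cite: Shimura1998, §8.2 Prop. 26] -/
theorem not_isSimple_of_multiset_eq {r s t h : ZMod M} (hh : IsUnit h) (hh1 : h ≠ 1)
    (hperm : ({h * r, h * s, h * t} : Multiset (ZMod M)) = {r, s, t})
    {hS : ∀ c : ZMod M, c.val.Coprime M → (c ∈ fermatCMType M r s t ↔ -c ∉ fermatCMType M r s t)}
    (hA : IsCMTypeRealisation (cmTypeOfResidues (L := L) (fermatCMType M r s t) hS) A ι θ) : ¬A.IsSimple := by
  obtain ⟨φ₀⟩ : Nonempty (L →+* ℂ) := inferInstance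
  refine not_isSimple_of_isCMTypeRealisation_of_not_isPrimitive hA φ₀ fun hP => ?_
  rw [CyclotomicCMTypeResidueSets.isPrimitive_iff_hasTrivialStabilizer M,
    CyclotomicCMTypeResidueSets.residueSet_cmTypeOfResidues M (isCMResidueSet_fermatCMType hS)] at hP
  exact not_hasTrivialStabilizer_of_multiset_eq hh hh1 hperm hP

/-- Existence of realisations of a Fermat type with non-zero entries summing to `0` (`M > 2`): the CM property of `H_{r,s,t}` (Aoki's (5),
tree `CyclotomicCMType.isCMTypeSet_fermatCMType`) and Shimura §6.2 Thm. 3 (tree `exists_isCMTypeRealisation`); the realisation has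
dimension `φ(M)/2`. [cite: Shimura1998, §6.2 Thm. 3] [cite: KoblitzRohrlich1978, §1 (p. 1183)] -/
theorem exists_isCMTypeRealisation_fermat (hM : 2 < M) {r s t : ZMod M} (hr : r ≠ 0) (hs : s ≠ 0) (ht : t ≠ 0)
    (hrst : r + s + t = 0) :
    ∃ (hS : ∀ c : ZMod M, c.val.Coprime M → (c ∈ fermatCMType M r s t ↔ -c ∉ fermatCMType M r s t))
      (B : Motives.AbelianVariety ℂ) (ι' : 𝓞 L →+* CategoryTheory.End B) (θ' : L →+* Module.End ℂ (complexBetti B.X 1)),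
      IsCMTypeRealisation (cmTypeOfResidues (L := L) (fermatCMType M r s t) hS) B ι' θ' ∧ B.dim = M.totient / 2 := by
  have hS := (CyclotomicCMType.isCMTypeSet_fermatCMType hr hs ht hrst).2
  haveI : IsCMField L := IsCyclotomicExtension.Rat.isCMField L (S := {M}) ⟨M, rfl, hM⟩
  obtain ⟨B, ι', θ', hB⟩ := exists_isCMTypeRealisation (cmTypeOfResidues (L := L) (fermatCMType M r s t) hS)
  exact ⟨hS, B, ι', θ', hB, dim_eq_of_realisation (N := M) hB⟩

end Stabiliser

/-! ## §2 The first family `{N/M, wN/M, w²N/M}`, `1 + w + w² = 0`: the triple `(1, w, w²) = (1, w, −1−w)` modulo `M` -/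

section FirstFamily

variable {M : ℕ} [NeZero M]

omit [NeZero M] in
/-- `1 + w + w² = 0` makes `w` a unit with inverse `−1 − w`. [folklore] -/
private theorem isUnit_of_one_add_add_sq {w : ZMod M} (hw : 1 + w + w ^ 2 = 0) : IsUnit w :=
  IsUnit.of_mul_eq_one (-1 - w) (by linear_combination -hw)

omit [NeZero M] in
/-- `1 + w + w² = 0` gives `w³ = 1` and `w² = −1 − w`. [folklore] -/
private theorem pow_three_of_one_add_add_sq {w : ZMod M} (hw : 1 + w + w ^ 2 = 0) : w ^ 3 = 1 ∧ w ^ 2 = -1 - w :=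
  ⟨by linear_combination (w - 1) * hw, by linear_combination hw⟩

omit [NeZero M] in
/-- `w·(1, w, −1−w) = (w, −1−w, 1)` is a permutation of `(1, w, −1−w)` when `1 + w + w² = 0`. [cite: KoblitzRohrlich1978, §1 (p. 1185)] -/
theorem multiset_eq_firstFamily {w : ZMod M} (hw : 1 + w + w ^ 2 = 0) :
    ({w * 1, w * w, w * (-1 - w)} : Multiset (ZMod M)) = {1, w, -1 - w} := by
  rw [mul_one, show w * w = -1 - w by linear_combination hw, show w * (-1 - w) = 1 by linear_combination -hw,
    triple_swap₂₃ w (-1 - w) 1, triple_swap₁₂ w 1 (-1 - w)]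

/-- **First family: `w` stabilises `H_{1,w,w²}`** — `w·(1, w, w²) = (w, w², w³) = (w, w², 1)` is a permutation of the triple, so `wH = H`
(`x ∈ H ⟺ wx ∈ H`), at EVERY level `M`; the triple is written `(1, w, −1−w)` (`w² = −1 − w`).
[cite: KoblitzRohrlich1978, §1 (p. 1185) and Theorem 2 (pp. 1185–1186)] -/
theorem forall_mem_iff_mul_mem_firstFamily {w : ZMod M} (hw : 1 + w + w ^ 2 = 0) (x : ZMod M) :
    x ∈ fermatCMType M 1 w (-1 - w) ↔ w * x ∈ fermatCMType M 1 w (-1 - w) :=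
  forall_mem_iff_mul_mem_of_multiset_eq (isUnit_of_one_add_add_sq hw) (multiset_eq_firstFamily hw) x

/-- **First family: `W_{1,w,w²} ≠ {1}`** for `w ≠ 1` with `1 + w + w² = 0`, at every level.
[cite: KoblitzRohrlich1978, §1 (pp. 1184–1185) and Theorem 2 (pp. 1185–1186)] -/
theorem not_hasTrivialStabilizer_firstFamily {w : ZMod M} (hw : 1 + w + w ^ 2 = 0) (hw1 : w ≠ 1) :
    ¬HasTrivialStabilizer M (fermatCMType M 1 w (-1 - w)) :=
  not_hasTrivialStabilizer_of_multiset_eq (isUnit_of_one_add_add_sq hw) hw1 (multiset_eq_firstFamily hw)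

variable {L : Type} [Field L] [NumberField L] [IsCyclotomicExtension {M} ℚ L]
  {A : Motives.AbelianVariety ℂ} {ι : 𝓞 L →+* CategoryTheory.End A} {θ : L →+* Module.End ℂ (complexBetti A.X 1)}

/-- **THEOREM 2, first family, converse direction at EVERY level `M`**: if `1 + w + w² = 0`, `w ≠ 1` in `ℤ/M`, no abelian variety of type
`(ℚ(ζ_M); Φ_{(1,w,w²)})` is simple ("The only lattices `L_{r,s,t}` which are not simple are those … equivalent to a triple of the form
`{N/M, ⟨wN/M⟩, ⟨w²N/M⟩}` … such that `1 + w + w² = 0`" — here: these ARE non-simple, with no hypothesis on `M`).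
[cite: KoblitzRohrlich1978, Theorem 2 (pp. 1185–1186)] [cite: Shimura1998, §8.2 Prop. 26] -/
theorem not_isSimple_firstFamily {w : ZMod M} (hw : 1 + w + w ^ 2 = 0) (hw1 : w ≠ 1)
    {hS : ∀ c : ZMod M, c.val.Coprime M → (c ∈ fermatCMType M 1 w (-1 - w) ↔ -c ∉ fermatCMType M 1 w (-1 - w))}
    (hA : IsCMTypeRealisation (cmTypeOfResidues (L := L) (fermatCMType M 1 w (-1 - w)) hS) A ι θ) : ¬A.IsSimple :=
  not_isSimple_of_multiset_eq (isUnit_of_one_add_add_sq hw) hw1 (multiset_eq_firstFamily hw) hA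

/-- **First family, non-vacuously** (`M > 2`): for `1 + w + w² = 0`, `w ≠ 1` there IS an abelian variety of type `Φ_{(1,w,w²)}`, of dimension
`φ(M)/2`, and it is not simple. [cite: KoblitzRohrlich1978, Theorem 2 (pp. 1185–1186)] [cite: Shimura1998, §6.2 Thm. 3, §8.2 Prop. 26] -/
theorem exists_not_isSimple_firstFamily (hM : 2 < M) {w : ZMod M} (hw : 1 + w + w ^ 2 = 0) (hw1 : w ≠ 1) :
    ∃ (hS : ∀ c : ZMod M, c.val.Coprime M → (c ∈ fermatCMType M 1 w (-1 - w) ↔ -c ∉ fermatCMType M 1 w (-1 - w)))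
      (B : Motives.AbelianVariety ℂ) (ι' : 𝓞 L →+* CategoryTheory.End B) (θ' : L →+* Module.End ℂ (complexBetti B.X 1)),
      IsCMTypeRealisation (cmTypeOfResidues (L := L) (fermatCMType M 1 w (-1 - w)) hS) B ι' θ' ∧
        ¬B.IsSimple ∧ B.dim = M.totient / 2 := by
  have hwu := isUnit_of_one_add_add_sq hw
  haveI : Nontrivial (ZMod M) := ZMod.nontrivial_iff.2 (by omega)
  have h1 : (1 : ZMod M) ≠ 0 := one_ne_zero
  have hw0 : w ≠ 0 := hwu.ne_zero
  have hw2 : (-1 - w : ZMod M) ≠ 0 := by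
    have hu : IsUnit (-1 - w : ZMod M) := IsUnit.of_mul_eq_one w (by linear_combination -hw)
    exact hu.ne_zero
  obtain ⟨hS, B, ι', θ', hB, hd⟩ := exists_isCMTypeRealisation_fermat (L := L) hM h1 hw0 hw2 (by ring)
  exact ⟨hS, B, ι', θ', hB, not_isSimple_firstFamily hw hw1 hB, hd⟩

end FirstFamily

/-! ## §3 The second family `{N/M, wN/M, −(1+w)N/M}`, `w² = 1`, `w ≠ ±1`: a boundary case (`1 + w` is not a unit), non-simple at every level -/

section SecondFamily

variable {M : ℕ} [NeZero M]

omit [NeZero M] in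
/-- **The second family is a boundary case**: if `w² = 1` and `w ≠ 1` then `1 + w` is NOT a unit of `ℤ/M` (`(w − 1)(w + 1) = w² − 1 = 0`
would force `w = 1`) — so the entry `−(1+w)N/M` of K–R's triple has a common factor with `M`.
[cite: KoblitzRohrlich1978, §1 (p. 1185) and §3 (p. 1193, "the boundary cases")] -/
theorem not_isUnit_one_add_of_sq_eq_one {w : ZMod M} (hw : w ^ 2 = 1) (hw1 : w ≠ 1) : ¬IsUnit (1 + w) := by
  intro hu
  obtain ⟨u, hu⟩ := hu
  apply hw1
  have h : (1 + w) * (w - 1) = 0 := by linear_combination hw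
  rw [← hu] at h
  have h' := congrArg (fun x => ((u⁻¹ : (ZMod M)ˣ) : ZMod M) * x) h
  simp only [← mul_assoc, Units.inv_mul, one_mul, mul_zero] at h'
  linear_combination h'

omit [NeZero M] in
/-- … while `w` itself is a unit (`w·w = 1`) and `−1 − w ≠ 0` for `w ≠ −1`. [folklore] -/
private theorem isUnit_of_sq_eq_one {w : ZMod M} (hw : w ^ 2 = 1) : IsUnit w :=
  IsUnit.of_mul_eq_one w (by rw [← sq]; exact hw)

omit [NeZero M] in
/-- `w·(1, w, −1−w) = (w, 1, −w−1)` is a permutation of `(1, w, −1−w)` when `w² = 1`. [cite: KoblitzRohrlich1978, §1 (p. 1185)] -/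
theorem multiset_eq_secondFamily {w : ZMod M} (hw : w ^ 2 = 1) :
    ({w * 1, w * w, w * (-1 - w)} : Multiset (ZMod M)) = {1, w, -1 - w} := by
  rw [mul_one, show w * w = 1 by rw [← sq]; exact hw, show w * (-1 - w) = -1 - w by linear_combination -hw,
    triple_swap₁₂ w 1 (-1 - w)]

/-- **Second family: `w` stabilises `H_{1,w,−1−w}`** (`w² = 1`): `x ∈ H ⟺ wx ∈ H`, at EVERY level `M`.
[cite: KoblitzRohrlich1978, §1 (p. 1185) and Theorem 2 (pp. 1185–1186)] -/
theorem forall_mem_iff_mul_mem_secondFamily {w : ZMod M} (hw : w ^ 2 = 1) (x : ZMod M) :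
    x ∈ fermatCMType M 1 w (-1 - w) ↔ w * x ∈ fermatCMType M 1 w (-1 - w) :=
  forall_mem_iff_mul_mem_of_multiset_eq (isUnit_of_sq_eq_one hw) (multiset_eq_secondFamily hw) x

/-- **Second family: `W_{1,w,−1−w} ≠ {1}`** for `w² = 1`, `w ≠ 1`, at every level. [cite: KoblitzRohrlich1978, §1 (pp. 1184–1185) and Theorem 2 (pp. 1185–1186)] -/
theorem not_hasTrivialStabilizer_secondFamily {w : ZMod M} (hw : w ^ 2 = 1) (hw1 : w ≠ 1) :
    ¬HasTrivialStabilizer M (fermatCMType M 1 w (-1 - w)) :=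
  not_hasTrivialStabilizer_of_multiset_eq (isUnit_of_sq_eq_one hw) hw1 (multiset_eq_secondFamily hw)

variable {L : Type} [Field L] [NumberField L] [IsCyclotomicExtension {M} ℚ L]
  {A : Motives.AbelianVariety ℂ} {ι : 𝓞 L →+* CategoryTheory.End A} {θ : L →+* Module.End ℂ (complexBetti A.X 1)}

/-- **THEOREM 2, second family, converse direction at EVERY level `M`**: if `w² = 1`, `w ≠ 1` in `ℤ/M`, no abelian variety of type
`(ℚ(ζ_M); Φ_{(1,w,−1−w)})` is simple ("… or to a triple of the form `{N/M, ⟨wN/M⟩, ⟨−(1+w)N/M⟩}` … such that `w² = 1`, `w ≠ ±1`" — these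
ARE non-simple; `w ≠ −1` is needed only for the triple to be a CM residue set, see `exists_not_isSimple_secondFamily`).
[cite: KoblitzRohrlich1978, Theorem 2 (pp. 1185–1186)] [cite: Shimura1998, §8.2 Prop. 26] -/
theorem not_isSimple_secondFamily {w : ZMod M} (hw : w ^ 2 = 1) (hw1 : w ≠ 1)
    {hS : ∀ c : ZMod M, c.val.Coprime M → (c ∈ fermatCMType M 1 w (-1 - w) ↔ -c ∉ fermatCMType M 1 w (-1 - w))}
    (hA : IsCMTypeRealisation (cmTypeOfResidues (L := L) (fermatCMType M 1 w (-1 - w)) hS) A ι θ) : ¬A.IsSimple :=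
  not_isSimple_of_multiset_eq (isUnit_of_sq_eq_one hw) hw1 (multiset_eq_secondFamily hw) hA

/-- **Second family, non-vacuously** (`M > 2`): for `w² = 1`, `w ≠ ±1` there IS an abelian variety of type `Φ_{(1,w,−1−w)}` (the entries
`1, w, −1−w` are non-zero and sum to `0`, so `H` is a CM residue set although `−1−w` is not a unit), of dimension `φ(M)/2`, and it is not
simple. [cite: KoblitzRohrlich1978, Theorem 2 (pp. 1185–1186)] [cite: Shimura1998, §6.2 Thm. 3, §8.2 Prop. 26] -/
theorem exists_not_isSimple_secondFamily (hM : 2 < M) {w : ZMod M} (hw : w ^ 2 = 1) (hw1 : w ≠ 1) (hw2 : w ≠ -1) :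
    ∃ (hS : ∀ c : ZMod M, c.val.Coprime M → (c ∈ fermatCMType M 1 w (-1 - w) ↔ -c ∉ fermatCMType M 1 w (-1 - w)))
      (B : Motives.AbelianVariety ℂ) (ι' : 𝓞 L →+* CategoryTheory.End B) (θ' : L →+* Module.End ℂ (complexBetti B.X 1)),
      IsCMTypeRealisation (cmTypeOfResidues (L := L) (fermatCMType M 1 w (-1 - w)) hS) B ι' θ' ∧
        ¬B.IsSimple ∧ B.dim = M.totient / 2 := by
  haveI : Nontrivial (ZMod M) := ZMod.nontrivial_iff.2 (by omega)
  have h1 : (1 : ZMod M) ≠ 0 := one_ne_zero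
  have hw0 : w ≠ 0 := (isUnit_of_sq_eq_one hw).ne_zero
  have hw3 : (-1 - w : ZMod M) ≠ 0 := fun h => hw2 (by linear_combination -h)
  obtain ⟨hS, B, ι', θ', hB, hd⟩ := exists_isCMTypeRealisation_fermat (L := L) hM h1 hw0 hw3 (by ring)
  exact ⟨hS, B, ι', θ', hB, not_isSimple_secondFamily hw hw1 hB, hd⟩

end SecondFamily

/-! ## §4 The smallest level prime to `6` with a second-family lattice: `M = 35`, `w = 6`, the triple `(1, 6, 28)` -/

section ThirtyFive

/-- `6² ≡ 1`, `6 ≢ ±1` modulo `35`; `−1 − 6 = 28`; `28 = 4·7` is not prime to `35` (kernel computation). [folklore] -/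
private theorem thirtyFive_facts :
    (6 : ZMod 35) ^ 2 = 1 ∧ (6 : ZMod 35) ≠ 1 ∧ (6 : ZMod 35) ≠ -1 ∧ (-1 - 6 : ZMod 35) = 28 ∧ ¬(28 : ZMod 35).val.Coprime 35 := by
  decide

/-- **The boundary lattice `L_{1,6,28}` at level `35`** (second family, `w = 6`: `6² ≡ 1 (mod 35)`, `6 ≢ ±1`):
`H_{1,6,28} = {1, 2, 3, 4, 6, 8, 9, 12, 13, 18, 19, 24}` (kernel computation) — note `28 = −(1+6)` is not a unit.
[cite: KoblitzRohrlich1978, Theorem 2 (pp. 1185–1186)] -/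
theorem fermatCMType_thirtyFive_one_six_twentyEight :
    fermatCMType 35 1 6 28 = {1, 2, 3, 4, 6, 8, 9, 12, 13, 18, 19, 24} := by
  decide

/-- `6·H_{1,6,28} = H_{1,6,28}` modulo `35`: `6 ∈ W_{1,6,28}` although `6 ∉ {1, ρ, ρ²}` for any cube root of unity — the second family of
Theorem 2 is non-empty at `M = 35`. [cite: KoblitzRohrlich1978, Theorem 2 (pp. 1185–1186)] -/
theorem forall_mem_iff_six_mul_mem_thirtyFive (x : ZMod 35) :
    x ∈ fermatCMType 35 1 6 (-1 - 6) ↔ 6 * x ∈ fermatCMType 35 1 6 (-1 - 6) :=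
  forall_mem_iff_mul_mem_secondFamily thirtyFive_facts.1 x

variable {L : Type} [Field L] [NumberField L] [IsCyclotomicExtension {35} ℚ L]

/-- **A non-simple `12`-dimensional abelian variety with CM by `ℚ(ζ₃₅)` of the boundary type `Φ_{(1,6,28)}` exists** — the second family of
Theorem 2 at the smallest level prime to `6` where it occurs. [cite: KoblitzRohrlich1978, Theorem 2 (pp. 1185–1186)] [cite: Shimura1998, §6.2 Thm. 3] -/
theorem exists_not_isSimple_thirtyFive :
    ∃ (hS : ∀ c : ZMod 35, c.val.Coprime 35 → (c ∈ fermatCMType 35 1 6 (-1 - 6) ↔ -c ∉ fermatCMType 35 1 6 (-1 - 6)))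
      (B : Motives.AbelianVariety ℂ) (ι' : 𝓞 L →+* CategoryTheory.End B) (θ' : L →+* Module.End ℂ (complexBetti B.X 1)),
      IsCMTypeRealisation (cmTypeOfResidues (L := L) (fermatCMType 35 1 6 (-1 - 6)) hS) B ι' θ' ∧
        ¬B.IsSimple ∧ B.dim = 12 := by
  obtain ⟨hS, B, ι', θ', hB, hBs, hd⟩ :=
    exists_not_isSimple_secondFamily (L := L) (M := 35) (by norm_num) thirtyFive_facts.1 thirtyFive_facts.2.1 thirtyFive_facts.2.2.1
  refine ⟨hS, B, ι', θ', hB, hBs, ?_⟩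
  rw [hd, show (35 : ℕ) = 5 * 7 from rfl, Nat.totient_mul (by norm_num), Nat.totient_prime (by norm_num),
    Nat.totient_prime (by norm_num)]

end ThirtyFive

end CyclotomicFermatCMType

end Literature.AlgebraicGeometry.ComplexMultiplication
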